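import Literature.Computability.AlgebraicComplexity.CKSV22UnlayeredABPLowerBound
import Literature.Computability.AlgebraicComplexity.CKSV22RobustSingularLocusABPBound
import HarnessLib

/-!
# CKSV 2022, Theorem 2 for an arbitrary polynomial with a robust singular-locus bound (§1.5, closing remark)

P. Chatterjee, M. Kumar, A. She, B. L. Volk, *Quadratic lower bounds for algebraic branching programs
and formulas*, comput. complex. **31** (2022) 8 (arXiv:1911.11793). §1.5 (TeX L205): "We remark
that the lower bound in Theorem 1.1 also holds for elementary symmetric polynomials of degree `0.1n`
on `n` variables. … In general, these lower bounds hold for any family of polynomials of high enough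
degree whose zeroes of multiplicity at least two lie in a low dimensional variety, or more formally,
an analog of Claim 9 or Lemma 24 is true."

This file proves the UNLAYERED-ABP lower bound of **Theorem 2 / Corollary 20** (tree:
`CKSV2022.chatterjeeKumarSheVolk2022_thm_2`, for `Σ x_iⁿ`) for ANY polynomial `f` under the robust
singular-locus hypothesis of `CKSV22RobustSingularLocusABPBound` (assembled in this tree; the printed
remark carries no proof):

  `hc`: for all `g_1, …, g_n` of degree `≤ d − 2`, every prime ideal of `F[x_1, …, x_n]` containing
  all `∂_i f − g_i` has height `≥ c`.

* `CKSV2022.thm_2_of_robustHeight` — over any field, if `f(0) = 0`, `2 ≤ d`, `1 ≤ Δ`,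
  `16·Δ·log₂ d ≤ d`, `c ≤ 2^a·d`, and `hc` holds, then every unlayered ABP with `m` edges and labels
  of degree `≤ Δ` computing `f` (`CKSV2022.UnlayeredABPComputes τ m Δ f`) satisfies
  `c·log₂ d ≤ 4·m·(log₂ log₂ d + log₂ Δ + 4 + a)`, i.e. `m = Ω(c log d/(log log d + log Δ + a))`.
  Proof = the tree's proof of Theorem 2 verbatim (prune to `τ' ≤ m + 2` vertices; if `τ' > 2^k`,
  `k = log₂ d + log₂ log₂ d + 2 + a`, there are already `≥ c log₂ d` edges; else ONE round of cuts
  `CKSV2022.exists_shallow_cut` with `r = log₂ log₂ d + log₂ Δ + 4 + a` removed bit classes leaves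
  formal degree `≤ Δ(2^{k−r} + 3) ≤ d`, and the robust Theorem 7 for `f`,
  `CKSV2022.thm_7_of_robustHeight`, gives `(d/Δ − 1)·c ≤ 4τ' + 2(d/Δ − 1)·c'` with `k·c' ≤ r·m`).
  The slack parameter `a` (allowing `c` up to `2^a·d`) only enters the two constants; for `Σ x_i^d`
  (`c = n = d`, `a = 0`, `robustHeight_psum`) this is `chatterjeeKumarSheVolk2022_thm_2` again, and
  for `ESYM(n,d)` (`c = n − (d−2)`) the hypothesis `hc` is CKSV Lemma 24 (not proved in this tree).

D-0026: no named facts, no definitions.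

## References
* [ChatterjeeKumarSheVolk2022] — §1.5 (closing remark), Theorem 2, Corollary 20, Theorem 7, Lemma 24.
-/

noncomputable section

open MvPolynomial Matrix Finset

namespace Literature.Computability.AlgebraicComplexity

namespace CKSV2022

open Kumar2019

section Main

variable {F : Type*} [Field F]

/-- A program without edges computes `0` between distinct vertices. [folklore] -/
private theorem pathSum_eq_zero_of_supp_card_eq_zero {τ : ℕ} {A : Type*} [CommRing A]
    {N : Matrix (Fin τ) (Fin τ) A} (hN : IsTopological N) (h0 : (supp N).card = 0) {s t : Fin τ}
    (hst : s ≠ t) : pathSum N s t = 0 := by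
  classical
  have hN0 : ∀ u v, N u v = 0 := by
    intro u v
    by_contra h
    have hmem : (u, v) ∈ supp N := mem_supp.2 h
    rw [Finset.card_eq_zero] at h0
    rw [h0] at hmem
    exact Finset.notMem_empty _ hmem
  rw [pathSum_apply_of_col_eq_zero hN (fun i => hN0 i t) s, if_neg hst]

/-- **CKSV Theorem 2 / Corollary 20 for an arbitrary polynomial with a robust singular-locus bound**
(§1.5, closing remark, made precise; explicit constants). Over a field `F`, let `f ∈ F[x_1,…,x_n]`
with `f(0) = 0`, `2 ≤ d`, `1 ≤ Δ` with `16·Δ·log₂ d ≤ d`, `c ≤ 2^a·d`, and suppose that for all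
`g_1, …, g_n` of degree `≤ d − 2` every prime containing all `∂_i f − g_i` has height `≥ c`. Then
every unlayered ABP with `m` edges and labels of degree `≤ Δ` computing `f` has
`c·log₂ d ≤ 4·m·(log₂ log₂ d + log₂ Δ + 4 + a)`. Assembled in this tree from
`CKSV2022.exists_shallow_cut` and `CKSV2022.thm_7_of_robustHeight`, along the printed proof of
Theorem 2. [cite: ChatterjeeKumarSheVolk2022, §1.5 (closing remark), Theorem 2, Corollary 20] -/
theorem thm_2_of_robustHeight {n d c a Δ τ m : ℕ} {f : MvPolynomial (Fin n) F}
    (hf0 : constantCoeff f = 0) (hd : 2 ≤ d) (hΔ : 1 ≤ Δ) (hbig : 16 * Δ * Nat.log 2 d ≤ d)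
    (hcd : c ≤ 2 ^ a * d)
    (hc : ∀ g : Fin n → MvPolynomial (Fin n) F, (∀ i, (g i).totalDegree ≤ d - 2) →
      ∀ 𝔭 : Ideal (MvPolynomial (Fin n) F), 𝔭.IsPrime → (∀ i, pderiv i f - g i ∈ 𝔭) →
        (c : ℕ∞) ≤ 𝔭.height)
    (h : UnlayeredABPComputes τ m Δ f) :
    c * Nat.log 2 d ≤ 4 * m * (Nat.log 2 (Nat.log 2 d) + Nat.log 2 Δ + 4 + a) := by
  classical
  obtain ⟨L, hL⟩ : ∃ L, L = Nat.log 2 d := ⟨_, rfl⟩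
  rw [← hL] at hbig ⊢
  -- trivial when `c = 0`
  rcases Nat.eq_zero_or_pos c with hc0 | hcpos
  · rw [hc0, zero_mul]; exact Nat.zero_le _
  have hLpos : 0 < L := by
    rw [hL]; exact Nat.log_pos Nat.one_lt_two hd
  -- `2^L ≤ d < 2^(L+1)`, `2^ℓ ≤ L < 2^(ℓ+1)`, `2^dℓ ≤ Δ < 2^(dℓ+1)`
  obtain ⟨ℓ, hℓ⟩ : ∃ ℓ, ℓ = Nat.log 2 L := ⟨_, rfl⟩
  obtain ⟨dℓ, hdℓ⟩ : ∃ dℓ, dℓ = Nat.log 2 Δ := ⟨_, rfl⟩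
  rw [← hℓ, ← hdℓ]
  have hn1 : 2 ^ L ≤ d := hL ▸ Nat.pow_log_le_self 2 (by omega)
  have hn2 : d < 2 ^ (L + 1) := hL ▸ Nat.lt_pow_succ_log_self Nat.one_lt_two d
  have hL1 : 2 ^ ℓ ≤ L := hℓ ▸ Nat.pow_log_le_self 2 hLpos.ne'
  have hL2 : L < 2 ^ (ℓ + 1) := hℓ ▸ Nat.lt_pow_succ_log_self Nat.one_lt_two L
  have hΔ1 : 2 ^ dℓ ≤ Δ := hdℓ ▸ Nat.pow_log_le_self 2 (by omega)
  have hΔ2 : Δ < 2 ^ (dℓ + 1) := hdℓ ▸ Nat.lt_pow_succ_log_self Nat.one_lt_two Δ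
  -- the program
  obtain ⟨s, t, N, hN, hs, ht, hdeg, hm, hcomp⟩ := h
  have hst : s ≠ t := by
    intro hst
    have h1 := pathSum_apply_self hN s
    rw [hst] at h1
    rw [hst, h1] at hcomp
    have := congrArg constantCoeff hcomp
    rw [hf0, map_one] at this
    exact one_ne_zero this
  -- there is at least one edge (else `f = 0`, contradicting `1 ≤ c`: take `g = 0`, `𝔭 = ⊥`)
  have hm1 : 1 ≤ m := by
    by_contra hm0
    have hcard0 : (supp N).card = 0 := by omega
    have hf : f = 0 := by rw [← hcomp]; exact pathSum_eq_zero_of_supp_card_eq_zero hN hcard0 hst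
    have hbot := hc (fun _ => 0) (fun i => by rw [totalDegree_zero]; exact Nat.zero_le _) ⊥
      Ideal.isPrime_bot fun i => by rw [hf, map_zero, sub_zero]; exact Ideal.zero_mem _
    rw [Ideal.height_bot] at hbot
    have : (c : ℕ∞) = 0 := nonpos_iff_eq_zero.1 hbot
    have : c = 0 := by exact_mod_cast this
    omega
  -- prune to `τ' ≤ m + 2` vertices
  obtain ⟨τ', e, s', t', he, hes, het, hτ', hP', hm'⟩ := exists_pruned N hN s t
  have hN' : IsTopological (N.submatrix e e) := isTopological_submatrix hN he
  have hs' : ∀ i, N.submatrix e e i s' = 0 := fun i => by rw [Matrix.submatrix_apply, hes, hs]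
  have ht' : ∀ j, N.submatrix e e t' j = 0 := fun j => by rw [Matrix.submatrix_apply, het, ht]
  have hdeg' : ∀ x y, (N.submatrix e e x y).totalDegree ≤ Δ := fun x y => hdeg _ _
  have hst' : s' ≠ t' := fun h0 => hst (by rw [← hes, ← het, h0])
  have hcomp' : pathSum (N.submatrix e e) s' t' = f := hP'.trans hcomp
  have hτm : τ' ≤ m + 2 := hτ'.trans (by omega)
  have hmm : (supp (N.submatrix e e)).card ≤ m := hm'.trans hm
  -- parameters
  obtain ⟨k, hk⟩ : ∃ k, k = L + ℓ + 2 + a := ⟨_, rfl⟩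
  obtain ⟨r, hr⟩ : ∃ r, r = ℓ + dℓ + 4 + a := ⟨_, rfl⟩
  have h4Δ : 4 * Δ ≤ d := le_trans (by nlinarith) hbig
  have hdL : dℓ + 2 ≤ L := by
    have h1 : 2 ^ (dℓ + 2) ≤ d := by
      calc 2 ^ (dℓ + 2) = 4 * 2 ^ dℓ := by ring
        _ ≤ 4 * Δ := Nat.mul_le_mul_left 4 hΔ1
        _ ≤ d := h4Δ
    have h2 : 2 ^ (dℓ + 2) < 2 ^ (L + 1) := lt_of_le_of_lt h1 hn2
    have := (Nat.pow_lt_pow_iff_right Nat.one_lt_two).1 h2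
    omega
  have hrk : r ≤ k := by omega
  have hr4 : 4 ≤ r := by omega
  -- target rewritten with `r`
  rw [show ℓ + dℓ + 4 + a = r from hr.symm]
  have hgoal_of : c * L ≤ 16 * m → c * L ≤ 4 * m * r := fun h16 =>
    h16.trans (by calc 16 * m = 4 * m * 4 := by ring
                 _ ≤ 4 * m * r := Nat.mul_le_mul_left _ hr4)
  by_cases hA : 2 ^ k < τ'
  · -- Case A: many vertices, hence many edges
    apply hgoal_of
    have h1 : c * L < 2 ^ k := by
      calc c * L ≤ 2 ^ a * d * L := Nat.mul_le_mul_right L hcd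
        _ < 2 ^ a * 2 ^ (L + 1) * L := by
            refine Nat.mul_lt_mul_of_pos_right ?_ hLpos
            exact Nat.mul_lt_mul_of_pos_left hn2 (Nat.two_pow_pos a)
        _ ≤ 2 ^ a * 2 ^ (L + 1) * 2 ^ (ℓ + 1) := Nat.mul_le_mul_left _ hL2.le
        _ = 2 ^ k := by rw [← pow_add, ← pow_add, hk]; congr 1; omega
    have h2 : c * L < m + 2 := (h1.trans hA).trans_le hτm
    omega
  · -- Case B: one round of cuts and the robust bound
    have hτk : τ' ≤ 2 ^ k := not_lt.1 hA
    obtain ⟨c', A, B, δ, hkc, hA0, hB0, hprog⟩ :=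
      exists_shallow_cut hN' hs' ht' hst' hdeg' hτk hrk
    rw [hcomp'] at hprog
    -- formal degree `≤ d`
    have hkr : k - r = L - dℓ - 2 := by omega
    have hdf : Δ * (2 ^ (k - r) + 3) ≤ d := by
      rw [hkr, Nat.mul_add]
      have hpow : 2 ^ (dℓ + 1) * 2 ^ (L - dℓ - 2) * 2 = 2 ^ L := by
        rw [← pow_add, ← pow_succ]; congr 1; omega
      have h1 : Δ * 2 ^ (L - dℓ - 2) * 2 < 2 ^ L := by
        rw [← hpow]
        exact Nat.mul_lt_mul_of_pos_right
          (Nat.mul_lt_mul_of_pos_right hΔ2 (Nat.two_pow_pos _)) Nat.two_pos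
      have h2 : 6 * Δ ≤ d := by
        have : 6 * Δ ≤ 16 * Δ * L := by
          calc 6 * Δ ≤ 16 * Δ * 1 := by omega
            _ ≤ 16 * Δ * L := Nat.mul_le_mul_left _ hLpos
        exact this.trans hbig
      omega
    have hprog' := hprog.mono_deg hdf
    have h7 := thm_7_of_robustHeight (K := F) hΔ hc A B hA0 hB0 (C δ)
      (by rw [totalDegree_C]; omega) hprog'
    -- `q = d/Δ − 1 ≥ 16 L − 1`
    obtain ⟨Q, hQ⟩ : ∃ Q, Q = d / Δ := ⟨_, rfl⟩
    have hQ16 : 16 * L ≤ Q := by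
      have h16 : 16 * L * Δ ≤ d := by
        calc 16 * L * Δ = 16 * Δ * L := by ring
          _ ≤ d := hbig
      rw [hQ]
      exact (Nat.le_div_iff_mul_le (by omega)).2 h16
    obtain ⟨q, hq⟩ : ∃ q, q = d / Δ - 1 := ⟨_, rfl⟩
    rw [← hq] at h7
    have hqQ : q = Q - 1 := by rw [hq, hQ]
    have hq15 : 15 * L ≤ q := by omega
    have hqpos : 0 < q := by omega
    have hkpos : 0 < k := by omega
    -- multiply Theorem 7 by `k` and use `k c' ≤ r m`
    have hkc' : k * c' ≤ r * m := hkc.trans (Nat.mul_le_mul_left r hmm)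
    have h8 : k * (q * c) ≤ 8 * (k * τ') ∨ k * (q * c) ≤ 4 * (q * (r * m)) := by
      have e1 : k * (q * c) ≤ k * (2 * (2 * τ') + 2 * q * c') := Nat.mul_le_mul_left k h7
      have e2 : k * (2 * (2 * τ') + 2 * q * c') = 4 * (k * τ') + 2 * (q * (k * c')) := by ring
      have e3 : q * (k * c') ≤ q * (r * m) := Nat.mul_le_mul_left q hkc'
      rw [e2] at e1
      omega
    rcases h8 with h8 | h8
    · -- (i) `q c ≤ 8 τ'`
      apply hgoal_of
      have h9 : q * c ≤ 8 * τ' := Nat.le_of_mul_le_mul_left (by linarith) hkpos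
      have h10 : 15 * L * c ≤ q * c := Nat.mul_le_mul_right c hq15
      have h11 : 15 * L * c = 15 * (c * L) := by ring
      have h12 : 15 * (c * L) ≤ 8 * m + 16 := by linarith
      omega
    · -- (ii) `k c ≤ 4 r m`
      have h9 : k * c ≤ 4 * (r * m) := by
        have : q * (k * c) ≤ q * (4 * (r * m)) := by linarith
        exact Nat.le_of_mul_le_mul_left this hqpos
      have h10 : L * c ≤ k * c := Nat.mul_le_mul_right c (by omega)
      linarith

end Main

end CKSV2022

end Literature.Computability.AlgebraicComplexity

end
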